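import Summits.BirchSwinnertonDyer.BirchSwinnertonDyer.Theorems.ManinLocalTwoThreeKodairaDiscUnitAtTwo
import Mathlib.NumberTheory.Padics.Hensel
import HarnessLib

/-!
# T-desc-IV♮(b) IS A THEOREM: on the tame cell `4 ∥ N`, Kodaira type `IV*` at `2`, `E(ℚ₂)[2] = 0 ⟺ Δ_min/2⁸ ≡ 5 (mod 8)`
# (cell bsd-f2-manin, descent lens MEMO-desc §33.15 / desc g15 ADDENDUM 7, prover ask P-desc-2; seat `bsd-line-manin23-p2` gen 12)

Summit `BirchSwinnertonDyer`, route `ManinLocalTwoThree`, crux C2 `ManinOddAtFour` (stmt-BirchSwinnertonDyer-22967), tame cell `4 ∥ N`.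
The descent lens' node T-desc-IV♮(b) `DescG15d.TypeFourStarLocalTwoTorsionCriterion` (HOME/desc/g15/Sketch-desc-g15d.lean 2350d04c8c9e2a61;
census 113/113 + OOS 102/102) says: for `W/ℚ` globally minimal with `4 ∥ N_W` and `v₂(Δ_min) = 8` (type `IV*` at `2`), the 2-division
cubic has NO root in `ℚ₂` iff `Δ_min/2⁸ ≡ 5 (mod 8)`.  THIS FILE PROVES IT BY VALUE (`typeFourStarLocalTwoTorsionCriterion`, statement
verbatim; the by-name corollary follows the typer's T-desc-22), with the pipeline of `…KodairaDiscUnitAtTwo` (T-desc-IV♭(b), p684861):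
Tate's `IV*`-normal form `[2α, 4α₂, 4α₃, 8α₄, 16α₆]` over `ℤ₂` (`exists_IVstarNormalForm_padicInt`, `α₃ ∈ ℤ₂ˣ`), whose 2-division
polynomial is `4·h`, `h = x³ + (α² + 4α₂)x² + 4(2α₄ + αα₃)x + 4(α₃² + 4α₆)`:

* §1 `IVstarCubic_ne_zero_of_not_isUnit` — `2 ∣ α` ⟹ `h` has no root in `ℚ₂` (the ultrametric case of the tree's
  `root_unique_of_IVstarCubic_padicInt`); `exists_IVstarCubic_root_of_isUnit` — `α ∈ ℤ₂ˣ` ⟹ `h` has a root (Mathlib's `hensels_lemma` at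
  `x = 1`: `h(1) ≡ 1 + α² ≡ 0`, `h′(1) ≡ 3 ≢ 0 (mod 2)`);
* §2 `Δ/2⁸ = −27α₃⁴ + 2α³α₃³ + 4α²M + 8R ≡ 5 (mod 8)` iff `2 ∣ α` (`zmod8_delta_eq_five_of_even`, `zmod8_delta_ne_five_of_odd`, `decide`);
* §3 the assembly — transport of roots along the `ℚ₂`-change of variables (`twoDivision_root_smul`), `Δ_min = u¹²·Δ(normal form)` with
  `u ∈ ℤ₂`, `u¹² ≡ 1 (mod 8)` (`zmod8_pow_twelve`, `zmod8_core_ne`).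

HONEST FRAMING: an E-blind local statement (Tate's algorithm casework + Hensel); it identifies imc's residual class R-IV′'s complement on the
`IV*` cell but proves nothing about Manin's conjecture or BSD.  No definitions, no named facts, no sorry.
-/

set_option linter.dupNamespace false
set_option autoImplicit false

noncomputable section

open scoped Classical
open Polynomial WeierstrassCurve IsDedekindDomain Rat.HeightOneSpectrum Literature.NumberTheory.EllipticCurves
open Summit.BirchSwinnertonDyer.Rank1Residual.ManinAdditive.TameTwoLocal
  Summit.BirchSwinnertonDyer.Rank1Residual.ManinAdditive.KodairaDiscUnit

namespace Summit.BirchSwinnertonDyer.BirchSwinnertonDyer.Theorems.ManinLocalTwoThree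

namespace LocalTwoTorsionDiscUnit

/-! ### §1 The `IV*`-cubic over `ℤ₂`: no root when `2 ∣ α`, a root when `α` is a unit -/

/-- **`2 ∣ α` ⟹ the `IV*`-cubic has no root in `ℚ₂`** (ultrametric: a root is integral; if `‖x‖ ≤ ½` the constant term `4(α₃² + 4α₆)`
(norm `¼`) dominates, if `‖x‖ = 1` the term `x³` dominates).  [cite: SilvermanATAEC1994, IV.9.4 (step 8)] -/
theorem IVstarCubic_ne_zero_of_not_isUnit {α α₂ α₃ α₄ α₆ : ℤ_[2]} (hα₃ : IsUnit α₃) (hα : ¬ IsUnit α) (x : ℚ_[2]) :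
    x ^ 3 + ((α ^ 2 + 4 * α₂ : ℤ_[2]) : ℚ_[2]) * x ^ 2 + ((4 * (2 * α₄ + α * α₃) : ℤ_[2]) : ℚ_[2]) * x +
      ((4 * (α₃ ^ 2 + 4 * α₆) : ℤ_[2]) : ℚ_[2]) ≠ 0 := by
  intro hx
  -- local norm tools
  have h2n : ‖((2 : ℤ_[2]) : ℚ_[2])‖ = 1 / 2 := by
    have e : ((2 : ℤ_[2]) : ℚ_[2]) = 2 := by exact_mod_cast PadicInt.coe_natCast 2
    rw [e]; have := Padic.norm_p (p := 2); norm_num at this ⊢; exact_mod_cast this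
  have hm1 : ∀ m : ℤ_[2], ‖(m : ℚ_[2])‖ ≤ 1 := fun m => by rw [← PadicInt.norm_def]; exact PadicInt.norm_le_one m
  have n4mul : ∀ m : ℤ_[2], ‖((4 * m : ℤ_[2]) : ℚ_[2])‖ ≤ 1 / 4 := fun m => by
    rw [show (4 * m : ℤ_[2]) = 2 * (2 * m) by ring]; push_cast
    rw [norm_mul, norm_mul, h2n]
    nlinarith [hm1 m, norm_nonneg (m : ℚ_[2])]
  have n8mul : ∀ m : ℤ_[2], ‖((8 * m : ℤ_[2]) : ℚ_[2])‖ ≤ 1 / 8 := fun m => by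
    rw [show (8 * m : ℤ_[2]) = 2 * (2 * (2 * m)) by ring]; push_cast
    rw [norm_mul, norm_mul, norm_mul, h2n]
    nlinarith [hm1 m, norm_nonneg (m : ℚ_[2])]
  have padicTwo_norm_le_half_of_lt_one : ∀ {x : ℚ_[2]}, ‖x‖ < 1 → ‖x‖ ≤ 1 / 2 := fun {x} h => by
    have := (Padic.norm_le_pow_iff_norm_lt_pow_add_one x (-1)).mpr (by norm_num; exact h)
    norm_num at this; exact this
  set B₂ : ℤ_[2] := α ^ 2 + 4 * α₂ with hB₂
  set B₄ : ℤ_[2] := 4 * (2 * α₄ + α * α₃) with hB₄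
  set B₆ : ℤ_[2] := 4 * (α₃ ^ 2 + 4 * α₆) with hB₆
  have nB₂ : ‖(B₂ : ℚ_[2])‖ ≤ 1 := PadicInt.norm_le_one _
  have nB₄ : ‖(B₄ : ℚ_[2])‖ ≤ 1 / 4 := by rw [hB₄]; exact n4mul _
  have nB₆ : ‖(B₆ : ℚ_[2])‖ ≤ 1 / 4 := by rw [hB₆]; exact n4mul _
  have nB₆' : 1 / 8 < ‖(B₆ : ℚ_[2])‖ := by
    have hδu : IsUnit (α₃ ^ 2 + 4 * α₆) := by
      by_contra hnu
      have hm : α₃ ^ 2 + 4 * α₆ ∈ RingHom.ker (PadicInt.toZMod (p := 2)) := by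
        rw [PadicInt.ker_toZMod]; exact (IsLocalRing.mem_maximalIdeal _).mpr hnu
      rw [RingHom.mem_ker, map_add, map_mul, map_pow, map_ofNat, toZMod_eq_one_of_isUnit hα₃] at hm
      revert hm; generalize PadicInt.toZMod (p := 2) α₆ = z; revert z; decide
    have hδ1 : ‖((α₃ ^ 2 + 4 * α₆ : ℤ_[2]) : ℚ_[2])‖ = 1 := by
      rw [← PadicInt.norm_def]; exact PadicInt.isUnit_iff.mp hδu
    rw [hB₆, show (4 * (α₃ ^ 2 + 4 * α₆) : ℤ_[2]) = 2 * (2 * (α₃ ^ 2 + 4 * α₆)) by ring]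
    push_cast [PadicInt.coe_mul] at hδ1 ⊢
    rw [norm_mul, norm_mul, h2n, hδ1]; norm_num
  have hx1 : ‖x‖ ≤ 1 := padic_norm_le_one_of_monic_cubic_root nB₂ (by linarith) (by linarith) hx
  obtain ⟨β, hβ⟩ := padicInt_two_eq_two_mul_of_not_isUnit hα
  have nB₂' : ‖(B₂ : ℚ_[2])‖ ≤ 1 / 4 := by
    rw [hB₂, hβ, show ((2 * β) ^ 2 + 4 * α₂ : ℤ_[2]) = 4 * (β ^ 2 + α₂) by ring]; exact n4mul _
  have nB₄' : ‖(B₄ : ℚ_[2])‖ ≤ 1 / 8 := by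
    rw [hB₄, hβ, show (4 * (2 * α₄ + 2 * β * α₃) : ℤ_[2]) = 8 * (α₄ + β * α₃) by ring]; exact n8mul _
  rcases hx1.lt_or_eq with hlt | heq
  · -- `‖x‖ ≤ 1/2`: `B₆` dominates
    have hx2 := padicTwo_norm_le_half_of_lt_one hlt
    refine padic_add_ne_zero_of_norm_lt (a := (B₆ : ℚ_[2]))
      (b := x ^ 3 + (B₂ : ℚ_[2]) * x ^ 2 + (B₄ : ℚ_[2]) * x) (padic_norm_add3_lt ?_ ?_ ?_) (by rw [← hx]; ring)
    · rw [norm_pow]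
      calc ‖x‖ ^ 3 ≤ (1 / 2) ^ 3 := by gcongr
        _ = 1 / 8 := by norm_num
        _ < _ := nB₆'
    · rw [norm_mul, norm_pow]
      calc ‖(B₂ : ℚ_[2])‖ * ‖x‖ ^ 2 ≤ (1 / 4) * (1 / 2) ^ 2 := by gcongr
        _ < 1 / 8 := by norm_num
        _ < _ := nB₆'
    · rw [norm_mul]
      calc ‖(B₄ : ℚ_[2])‖ * ‖x‖ ≤ (1 / 8) * (1 / 2) := by gcongr
        _ < 1 / 8 := by norm_num
        _ < _ := nB₆'
  · -- `‖x‖ = 1`: `x³` dominates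
    refine padic_add_ne_zero_of_norm_lt (a := x ^ 3)
      (b := (B₂ : ℚ_[2]) * x ^ 2 + (B₄ : ℚ_[2]) * x + (B₆ : ℚ_[2])) ?_ (by rw [← hx]; ring)
    rw [norm_pow, heq, one_pow]
    refine padic_norm_add3_lt ?_ ?_ ?_
    · rw [norm_mul, norm_pow, heq, one_pow, mul_one]; linarith
    · rw [norm_mul, heq, mul_one]; linarith
    · linarith

/-- **`α ∈ ℤ₂ˣ` ⟹ the `IV*`-cubic has a root in `ℚ₂`** (Hensel at `x = 1`: `h(1) ≡ 1 + α² ≡ 0 (mod 2)`, `h′(1) ≡ 1 (mod 2)`).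
[cite: SilvermanATAEC1994, IV.9.4 (step 8)] -/
theorem exists_IVstarCubic_root_of_isUnit {α α₂ α₃ α₄ α₆ : ℤ_[2]} (hα : IsUnit α) :
    ∃ x : ℚ_[2], x ^ 3 + ((α ^ 2 + 4 * α₂ : ℤ_[2]) : ℚ_[2]) * x ^ 2 + ((4 * (2 * α₄ + α * α₃) : ℤ_[2]) : ℚ_[2]) * x +
      ((4 * (α₃ ^ 2 + 4 * α₆) : ℤ_[2]) : ℚ_[2]) = 0 := by
  set B₂ : ℤ_[2] := α ^ 2 + 4 * α₂ with hB₂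
  set B₄ : ℤ_[2] := 4 * (2 * α₄ + α * α₃) with hB₄
  set B₆ : ℤ_[2] := 4 * (α₃ ^ 2 + 4 * α₆) with hB₆
  set F : Polynomial ℤ_[2] := X ^ 3 + C B₂ * X ^ 2 + C B₄ * X + C B₆ with hF
  have hev : ∀ z : ℤ_[2], F.aeval z = z ^ 3 + B₂ * z ^ 2 + B₄ * z + B₆ := fun z => by
    simp [hF]
  have hder : ∀ z : ℤ_[2], F.derivative.aeval z = 3 * z ^ 2 + 2 * B₂ * z + B₄ := fun z => by
    simp [hF, derivative_mul, map_ofNat]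
    ring
  have hα1 : PadicInt.toZMod (p := 2) α = 1 := toZMod_eq_one_of_isUnit hα
  -- `h(1)` is not a unit, `h'(1)` is a unit
  have hval : ¬ IsUnit (F.aeval (1 : ℤ_[2])) := by
    intro hu
    have h1 := toZMod_eq_one_of_isUnit hu
    rw [hev, hB₂, hB₄, hB₆] at h1
    simp only [map_add, map_mul, map_pow, map_ofNat, map_one, hα1] at h1
    revert h1
    generalize PadicInt.toZMod (p := 2) α₂ = a
    generalize PadicInt.toZMod (p := 2) α₃ = b
    generalize PadicInt.toZMod (p := 2) α₄ = c
    generalize PadicInt.toZMod (p := 2) α₆ = d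
    revert a b c d; decide
  have hder1 : IsUnit (F.derivative.aeval (1 : ℤ_[2])) := by
    by_contra hnu
    have hm : F.derivative.aeval (1 : ℤ_[2]) ∈ RingHom.ker (PadicInt.toZMod (p := 2)) := by
      rw [PadicInt.ker_toZMod]; exact (IsLocalRing.mem_maximalIdeal _).mpr hnu
    rw [RingHom.mem_ker, hder, hB₂, hB₄] at hm
    simp only [map_add, map_mul, map_pow, map_ofNat, map_one, hα1] at hm
    revert hm
    generalize PadicInt.toZMod (p := 2) α₂ = a
    generalize PadicInt.toZMod (p := 2) α₃ = b
    generalize PadicInt.toZMod (p := 2) α₄ = c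
    revert a b c; decide
  have hnorm : ‖F.aeval (1 : ℤ_[2])‖ < ‖F.derivative.aeval (1 : ℤ_[2])‖ ^ 2 := by
    rw [PadicInt.isUnit_iff.mp hder1, one_pow]
    exact lt_of_le_of_ne (PadicInt.norm_le_one _) (fun h => hval (PadicInt.isUnit_iff.mpr h))
  obtain ⟨z, hz, -⟩ := hensels_lemma hnorm
  refine ⟨(z : ℚ_[2]), ?_⟩
  rw [hev] at hz
  have := congrArg (fun t : ℤ_[2] => (t : ℚ_[2])) hz
  simpa [hB₂, hB₄, hB₆] using this

/-- The converse bookkeeping of `IVstarCubic_eq_zero_of_twoDivision_root`: a root of the `IV*`-cubic is a root of the 2-division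
polynomial of the normal form. [folklore] -/
theorem twoDivision_root_of_IVstarCubic_eq_zero (M : WeierstrassCurve ℤ_[2]) {α α₂ α₃ α₄ α₆ : ℤ_[2]}
    (h₁ : M.a₁ = 2 * α) (h₂ : M.a₂ = 4 * α₂) (h₃ : M.a₃ = 4 * α₃) (h₄ : M.a₄ = 8 * α₄) (h₆ : M.a₆ = 16 * α₆)
    {x : ℚ_[2]} (hx : x ^ 3 + ((α ^ 2 + 4 * α₂ : ℤ_[2]) : ℚ_[2]) * x ^ 2 + ((4 * (2 * α₄ + α * α₃) : ℤ_[2]) : ℚ_[2]) * x +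
      ((4 * (α₃ ^ 2 + 4 * α₆) : ℤ_[2]) : ℚ_[2]) = 0) :
    4 * x ^ 3 + (M.map PadicInt.Coe.ringHom).b₂ * x ^ 2 + 2 * (M.map PadicInt.Coe.ringHom).b₄ * x +
      (M.map PadicInt.Coe.ringHom).b₆ = 0 := by
  simp only [WeierstrassCurve.b₂, WeierstrassCurve.b₄, WeierstrassCurve.b₆, map_a₁, map_a₂, map_a₃, map_a₄, map_a₆,
    h₁, h₂, h₃, h₄, h₆]
  have c2 : ((2 : ℤ_[2]) : ℚ_[2]) = 2 := by exact_mod_cast PadicInt.coe_natCast 2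
  have c4 : ((4 : ℤ_[2]) : ℚ_[2]) = 4 := by exact_mod_cast PadicInt.coe_natCast 4
  have c8 : ((8 : ℤ_[2]) : ℚ_[2]) = 8 := by exact_mod_cast PadicInt.coe_natCast 8
  have c16 : ((16 : ℤ_[2]) : ℚ_[2]) = 16 := by exact_mod_cast PadicInt.coe_natCast 16
  have e : ∀ z : ℤ_[2], (PadicInt.Coe.ringHom (p := 2)) z = (z : ℚ_[2]) := fun z => rfl
  simp only [e]
  push_cast at hx ⊢
  simp only [c2, c4, c8, c16] at hx ⊢
  linear_combination 4 * hx

/-! ### §2 `Δ/2⁸ (mod 8)` and the parity of `α` -/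

/-- `2 ∣ α` ⟹ `−27α₃⁴ + 2α³α₃³ + 4α²M ≡ 5 (mod 8)` (`α₃` odd). [folklore] -/
theorem zmod8_delta_eq_five_of_even (t y m : ZMod (2 ^ 3)) (hy : y * y = 1) :
    -27 * y ^ 4 + 2 * (2 * t) ^ 3 * y ^ 3 + 4 * (2 * t) ^ 2 * m = 5 := by
  revert t y m; decide

/-- `α` odd ⟹ `−27α₃⁴ + 2α³α₃³ + 4α²M ≢ 5 (mod 8)` (it is `≡ 3 (mod 4)`). [folklore] -/
theorem zmod8_delta_ne_five_of_odd (a y m : ZMod (2 ^ 3)) (ha : a * a = 1) (hy : y * y = 1) :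
    -27 * y ^ 4 + 2 * a ^ 3 * y ^ 3 + 4 * a ^ 2 * m ≠ 5 := by
  revert a y m; decide

/-! ### §3 T-desc-IV♮(b) by value -/

/-- **T-desc-IV♮(b) `DescG15d.TypeFourStarLocalTwoTorsionCriterion` BY VALUE (statement verbatim; census 113/113 + OOS 102/102)**: on the
tame cell `4 ∥ N`, for Kodaira type `IV*` at `2` (`v₂(Δ_min) = 8`): `E(ℚ₂)[2] = 0` (no `ℚ₂`-root of the 2-division cubic,
`TameTwoLocal.NoLocalTwoTorsionAtTwo`) ⟺ `Δ_min/2⁸ ≡ 5 (mod 8)`.  [cite: SilvermanATAEC1994, IV.9.4 and Table 4.1] -/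
theorem typeFourStarLocalTwoTorsionCriterion :
    ∀ (W : WeierstrassCurve ℚ) [W.IsElliptic] [W.IsGloballyMinimal],
      2 ^ 2 ∣ W.conductorNorm ℤ → ¬ 2 ^ 3 ∣ W.conductorNorm ℤ →
        padicValInt 2 W.minimalDiscriminantInt = 8 →
          (NoLocalTwoTorsionAtTwo W ↔ W.minimalDiscriminantInt / 2 ^ 8 ≡ 5 [ZMOD 8]) := by
  intro W _ _ h4 h8 hΔ8
  -- Kodaira `IV*` at the place of `ℤ` above `2`, read over `ℤ₂`
  set v : IsDedekindDomain.HeightOneSpectrum ℤ := (Rat.HeightOneSpectrum.primesEquiv (R := ℤ)).symm ⟨2, Nat.prime_two⟩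
    with hvdef
  have hv : Rat.HeightOneSpectrum.natGenerator v = 2 :=
    Literature.NumberTheory.EllipticCurves.Rat.natGenerator_primesEquiv_symm ⟨2, Nat.prime_two⟩
  have hK : W.kodairaSymbolAt v = .IVstar := by
    rcases W.kodairaSymbolAt_of_four_dvd_conductorNorm v hv h4 h8 with ⟨-, h⟩ | ⟨h, -⟩
    · rw [hΔ8] at h; norm_num at h
    · exact h
  have e : Rat.HeightOneSpectrum.primesEquiv (R := ℤ) v = ⟨2, Nat.prime_two⟩ := Equiv.apply_symm_apply _ _
  have hKp := WeierstrassCurve.kodairaSymbolAt_eq_padic (R := ℤ) v W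
  rw [e] at hKp
  change W.kodairaSymbolAt v = (((W.baseChange ℚ_[2]).minimal ℤ_[2]).integralModel ℤ_[2]).kodairaSymbolOfMinimal at hKp
  rw [hK] at hKp
  set X : WeierstrassCurve ℚ_[2] := W.baseChange ℚ_[2] with hX
  set V₀ : WeierstrassCurve ℤ_[2] := (X.minimal ℤ_[2]).integralModel ℤ_[2] with hV₀
  obtain ⟨D, α, α₂, α₃, α₄, α₆, h₁, h₂, h₃, hα₃, h₄', h₆⟩ := exists_IVstarNormalForm_padicInt V₀ hKp.symm
  -- the total change of variables over `ℚ₂`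
  set E : WeierstrassCurve.VariableChange ℚ_[2] := (X.exists_isMinimal ℤ_[2]).choose with hE
  have hmin : X.minimal ℤ_[2] = E • X := rfl
  have hV₀X : V₀.baseChange ℚ_[2] = X.minimal ℤ_[2] := WeierstrassCurve.baseChange_integralModel_eq ℤ_[2] _
  set Ctot : WeierstrassCurve.VariableChange ℚ_[2] := D.map (algebraMap ℤ_[2] ℚ_[2]) * E with hCtot
  have hCX : Ctot • X = (D • V₀).map (algebraMap ℤ_[2] ℚ_[2]) := by
    rw [hCtot, mul_smul, ← hmin, ← hV₀X]
    exact WeierstrassCurve.map_variableChange _ _ _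
  have halg : algebraMap ℤ_[2] ℚ_[2] = PadicInt.Coe.ringHom := rfl
  -- `W`'s 2-division polynomial over `ℚ₂` is `X`'s
  have hrat : ∀ q : ℚ, algebraMap ℚ ℚ_[2] q = (q : ℚ_[2]) := fun q => by rw [eq_ratCast]
  have hXb : X.b₂ = (W.b₂ : ℚ_[2]) ∧ X.b₄ = (W.b₄ : ℚ_[2]) ∧ X.b₆ = (W.b₆ : ℚ_[2]) := by
    rw [hX, WeierstrassCurve.baseChange, map_b₂, map_b₄, map_b₆, hrat, hrat, hrat]; exact ⟨rfl, rfl, rfl⟩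
  -- STEP 1: `NoLocalTwoTorsionAtTwo W ↔ ¬ IsUnit α`
  have hstep1 : NoLocalTwoTorsionAtTwo W ↔ ¬ IsUnit α := by
    constructor
    · intro hno hαu
      obtain ⟨t, ht⟩ := exists_IVstarCubic_root_of_isUnit (α₂ := α₂) (α₃ := α₃) (α₄ := α₄) (α₆ := α₆) hαu
      have h1 := twoDivision_root_of_IVstarCubic_eq_zero (D • V₀) h₁ h₂ h₃ h₄' h₆ ht
      rw [← halg, ← hCX] at h1
      have h2 := twoDivision_root_smul (Ctot • X) Ctot⁻¹ h1
      rw [inv_smul_smul, hXb.1, hXb.2.1, hXb.2.2] at h2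
      exact hno _ h2
    · intro hα t ht
      have ht' : 4 * t ^ 3 + X.b₂ * t ^ 2 + 2 * X.b₄ * t + X.b₆ = 0 := by rw [hXb.1, hXb.2.1, hXb.2.2]; exact ht
      have h := twoDivision_root_smul X Ctot ht'
      rw [hCX, halg] at h
      exact IVstarCubic_ne_zero_of_not_isUnit hα₃ hα _ (IVstarCubic_eq_zero_of_twoDivision_root (D • V₀) h₁ h₂ h₃ h₄' h₆ h)
  -- STEP 2: the discriminant of the normal form and `Δ_min`
  set M' : ℤ_[2] := -15 * α₃ ^ 2 * α₄ + α ^ 2 * α₄ ^ 2 - α ^ 2 * α₂ * α₃ ^ 2 + α ^ 3 * α₃ * α₄ - α ^ 4 * α₆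
    with hM'
  set R' : ℤ_[2] := -54 * α₆ ^ 2 - 16 * α₄ ^ 3 - 27 * α₃ ^ 2 * α₆ + 72 * α₂ * α₄ * α₆ + 18 * α₂ * α₃ ^ 2 * α₄
             + 8 * α₂ ^ 2 * α₄ ^ 2 - 32 * α₂ ^ 3 * α₆ - 8 * α₂ ^ 3 * α₃ ^ 2 - 24 * α * α₃ * α₄ ^ 2
             + 36 * α * α₂ * α₃ * α₆ + 9 * α * α₂ * α₃ ^ 3 + 8 * α * α₂ ^ 2 * α₃ * α₄ + 18 * α ^ 2 * α₄ * α₆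
             + 4 * α ^ 2 * α₂ * α₄ ^ 2 - 24 * α ^ 2 * α₂ ^ 2 * α₆ - 4 * α ^ 2 * α₂ ^ 2 * α₃ ^ 2
             + 9 * α ^ 3 * α₃ * α₆ + 4 * α ^ 3 * α₂ * α₃ * α₄ - 6 * α ^ 4 * α₂ * α₆ with hR'
  set δ : ℤ_[2] := -27 * α₃ ^ 4 + 2 * α ^ 3 * α₃ ^ 3 + 4 * α ^ 2 * M' + 8 * R' with hδ
  have hNΔ : (D • V₀).Δ = 2 ^ 8 * δ := by
    rw [hδ, hM', hR']; exact Δ_IVstarNormalForm (D • V₀) h₁ h₂ h₃ h₄' h₆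
  have hΔne : W.minimalDiscriminantInt ≠ 0 := minimalDiscriminantInt_ne_zero W
  obtain ⟨m, hm⟩ : (2 : ℤ) ^ 8 ∣ W.minimalDiscriminantInt := by
    have := (padicValInt_dvd_iff (p := 2) 8 W.minimalDiscriminantInt).mpr (Or.inr (by omega))
    exact_mod_cast this
  have hm_odd : ¬ (2 : ℤ) ∣ m := by
    rintro ⟨k, hk⟩
    have h9 : ((2 : ℕ) : ℤ) ^ 9 ∣ W.minimalDiscriminantInt := ⟨k, by rw [hm, hk]; ring⟩
    rw [padicValInt_dvd_iff] at h9
    rcases h9 with h0 | h9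
    · exact hΔne h0
    · omega
  have hdiv : W.minimalDiscriminantInt / 2 ^ 8 = m := by
    rw [hm]; exact Int.mul_ediv_cancel_left _ (by norm_num)
  rw [hdiv]
  -- the `ℚ₂` side: `Δ(D • V₀) = u'^12 · Δ_min`
  have hXΔ : X.Δ = ((W.minimalDiscriminantInt : ℚ) : ℚ_[2]) := by
    rw [hX, WeierstrassCurve.baseChange, map_Δ, cast_minimalDiscriminantInt, eq_ratCast]
  set u' : ℚ_[2] := ((Ctot.u⁻¹ : ℚ_[2]ˣ) : ℚ_[2]) with hu'
  have halg' : ∀ z : ℤ_[2], algebraMap ℤ_[2] ℚ_[2] z = (z : ℚ_[2]) := fun z => rfl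
  have h1 := variableChange_Δ X Ctot
  rw [hCX, map_Δ, hNΔ, hXΔ, hm, halg'] at h1
  have h1' : (2 : ℚ_[2]) ^ 8 * (δ : ℚ_[2]) = (2 : ℚ_[2]) ^ 8 * (u' ^ 12 * (m : ℚ_[2])) := by
    have h := h1
    rw [← hu'] at h
    push_cast at h
    have e2 : ((2 : ℤ_[2]) : ℚ_[2]) = 2 := by exact_mod_cast PadicInt.coe_natCast 2
    rw [e2] at h
    linear_combination h
  have h2ne : (2 : ℚ_[2]) ^ 8 ≠ 0 := pow_ne_zero _ two_ne_zero
  have hδu : (δ : ℚ_[2]) = u' ^ 12 * (m : ℚ_[2]) := mul_left_cancel₀ h2ne h1'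
  have hmnorm : ‖(m : ℚ_[2])‖ = 1 := by
    have hle := Padic.norm_int_le_one (p := 2) m
    have hlt : ¬ ‖(m : ℚ_[2])‖ < 1 := by
      rw [Padic.norm_intCast_lt_one_iff]; exact_mod_cast hm_odd
    exact le_antisymm hle (not_lt.mp hlt)
  have hu'le : ‖u'‖ ≤ 1 := by
    have hδle : ‖(δ : ℚ_[2])‖ ≤ 1 := by rw [← PadicInt.norm_def]; exact PadicInt.norm_le_one δ
    rw [hδu, norm_mul, norm_pow, hmnorm, mul_one] at hδle
    exact (pow_le_one_iff_of_nonneg (norm_nonneg _) (by norm_num)).mp hδle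
  set u₀ : ℤ_[2] := ⟨u', hu'le⟩ with hu₀
  have hδ₀ : δ = u₀ ^ 12 * (m : ℤ_[2]) := by
    apply Subtype.ext
    push_cast
    rw [hδu]
  -- reduction mod 8: `δ ≡ m (mod 8)` (because `δ ≢ 0`, so `u₀¹² ≡ 1`)
  have hπ := congrArg (PadicInt.toZModPow 3 : ℤ_[2] →+* ZMod (2 ^ 3)) hδ₀
  rw [map_mul, map_pow, map_intCast] at hπ
  have hδπ : PadicInt.toZModPow 3 δ =
      -27 * (PadicInt.toZModPow 3 α₃) ^ 4 + 2 * (PadicInt.toZModPow 3 α) ^ 3 * (PadicInt.toZModPow 3 α₃) ^ 3 +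
        4 * (PadicInt.toZModPow 3 α) ^ 2 * (PadicInt.toZModPow 3 M') := by
    rw [hδ]
    simp only [map_add, map_mul, map_pow, map_neg, map_ofNat]
    have h8 : (8 : ZMod (2 ^ 3)) = 0 := by decide
    rw [h8, zero_mul, add_zero]
  obtain ⟨β₃, hβ₃⟩ := hα₃.exists_right_inv
  have hy : PadicInt.toZModPow 3 α₃ * PadicInt.toZModPow 3 α₃ = 1 :=
    zmod8_sq_eq_one_of_mul_eq_one _ (PadicInt.toZModPow 3 β₃) (by rw [← map_mul, hβ₃, map_one])
  obtain ⟨hne0, -⟩ := zmod8_core_ne (PadicInt.toZModPow 3 α) (PadicInt.toZModPow 3 α₃) (PadicInt.toZModPow 3 M') hy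
  rw [← hδπ] at hne0
  have hu12 : PadicInt.toZModPow 3 u₀ ^ 12 = 1 := by
    rcases zmod8_pow_twelve (PadicInt.toZModPow 3 u₀) with h0 | h1
    · exfalso; apply hne0; rw [hπ, h0, zero_mul]
    · exact h1
  rw [hu12, one_mul] at hπ
  -- `hπ : toZModPow 3 δ = (m : ZMod 8)`
  have hm8 : (m ≡ 5 [ZMOD 8]) ↔ ((m : ℤ) : ZMod (2 ^ 3)) = 5 := by
    constructor
    · intro hmod
      have hmod' : m ≡ 5 [ZMOD ((2 ^ 3 : ℕ) : ℤ)] := by norm_num; exact hmod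
      have h := (ZMod.intCast_eq_intCast_iff (a := m) (b := 5) (c := 2 ^ 3)).mpr hmod'
      simpa using h
    · intro h
      have h' : ((m : ℤ) : ZMod (2 ^ 3)) = ((5 : ℤ) : ZMod (2 ^ 3)) := by simpa using h
      have := (ZMod.intCast_eq_intCast_iff (a := m) (b := 5) (c := 2 ^ 3)).mp h'
      norm_num at this; exact this
  rw [hstep1, hm8, ← hπ, hδπ]
  -- STEP 3: parity of `α`
  constructor
  · intro hα
    obtain ⟨w, hw⟩ := padicInt_two_eq_two_mul_of_not_isUnit hα
    rw [hw, map_mul, map_ofNat]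
    exact zmod8_delta_eq_five_of_even _ _ _ hy
  · intro h5 hαu
    obtain ⟨β, hβ⟩ := hαu.exists_right_inv
    have ha : PadicInt.toZModPow 3 α * PadicInt.toZModPow 3 α = 1 :=
      zmod8_sq_eq_one_of_mul_eq_one _ (PadicInt.toZModPow 3 β) (by rw [← map_mul, hβ, map_one])
    exact zmod8_delta_ne_five_of_odd _ _ _ ha hy h5

end LocalTwoTorsionDiscUnit

end Summit.BirchSwinnertonDyer.BirchSwinnertonDyer.Theorems.ManinLocalTwoThree

end
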